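import Summits.CriticalPhenomena.PercolationContinuityZ3.Theorems.PercNearOneGluingNoHeavyLowerTailSahiCTCRtThreeSignedForm
import HarnessLib

/-!
# `NoHeavyLowerTail` (crux stmt-CriticalPhenomena-4575), P3 lane: the BIG-HARRIS (edge) form of `R_3` —
# `R_3 = Θ₂·H(F₃,G₃) − Θ₂·(X₃·Z_{<3} + X_{<3}·Z₃) + e_{≥3}·X_{<3}·Z_{<3}` and its squarefree coefficients

Support file (seat `prim-l12-p3`, gen 47; `--supports stmt-CriticalPhenomena-4575`).  Memo
`run/shared/lean/prim/prim-l12/FROM-prim-l12-p3-g47-TRANSPORT-CERTIFICATES.md` §2.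

Write `X₃ = GF(F_{≥3})`, `X_{<3} = GF(F_{<3})` (for a loop-free up-set these are the big members and the EDGES of `F`), similarly for
`G`, `Θ₂ = GF(sets of size < 3)`, `e_{≥3} = GF(sets of size ≥ 3)`, `Π = Θ₂ + e_{≥3}`, and `H(A,B) = Π·GF(A∩B) − GF(A)·GF(B)` (the Harris form,
whose coefficients are the Kleitman surpluses `kap` of sub-cubes).  Splitting `X = X₃ + X_{<3}`, `Z = Z₃ + Z_{<3}` in the definition
`R_3 = Θ₂·(Π·Y_{≥3} − X·Z) + Π·X_{<3}·Z_{<3}` gives the polynomial identity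
* `Rt_three_eq_bigHarris` : **`R_3 = Θ₂·H(F₃,G₃) − Θ₂·(X₃·Z_{<3} + X_{<3}·Z₃) + e_{≥3}·X_{<3}·Z_{<3}`** (all pairs, all profiles):
  the only negative block pairs a BIG member of one family with a SMALL member of the other;
and at a squarefree monomial `s^V` (every `k = #V`):
* `coeff_ind_bySize_mul_gf_mul_gf` : `[s^V] GF({S : p #S})·GF(A)·GF(B) = Σ_{S ⊆ V, p #S} #{(P,Q) ∈ A × B partitioning V∖S}`;
* **`coeff_ind_Rt_three_eq_bigHarris`** :
  `[s^V] R_3 = Σ_{U ⊆ V, #U ≤ 2} κ(F₃,G₃)(∅, V∖U) − Σ_{U ⊆ V, #U ≤ 2} (#pairs(F₃,G_{<3}) + #pairs(F_{<3},G₃))(V∖U)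
   + Σ_{S ⊆ V, 3 ≤ #S} #pairs(F_{<3},G_{<3})(V∖S)`
  — "Kleitman surpluses of the BIG parts on the top cubes + disjoint (F-edge, G-edge) pairs with ≥ 3 idle points ≥ (big member of one
  family, small member of the other) complementary pairs of the top cubes" is exactly the squarefree row of `R_3 ∈ ℕ[s]` (memo §2, (★★):
  for loop-free pairs the negative block is `Σ_{z ∈ E_G} t_F(z) + Σ_{c ∈ E_F} t_G(c)`, `t_F(z) = #{U ⊆ V∖z, #U ≤ 2 : V∖U∖z ∈ F}`);
* `coeff_ind_Rt_three_nonneg_of_bigHarris_le` : the corresponding sufficient condition.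
Nothing is asserted about the crux.
-/

noncomputable section

open scoped Classical

namespace Summit.CriticalPhenomena.PercolationContinuityZ3.Theorems.SahiCTCForms

open Finset MvPolynomial SahiCTCGenFun

variable {α : Type*} [DecidableEq α] [Fintype α]

omit [Fintype α] in
/-- The members of size `≥ t` of an intersection are the intersection of the members of size `≥ t`. [this work] -/
theorem atLeast_inter (t : ℕ) (F G : Finset (Finset α)) : atLeast t (F ∩ G) = atLeast t F ∩ atLeast t G := by
  ext S; simp only [atLeast, mem_filter, mem_inter]; tauto

/-- **THE BIG-HARRIS FORM OF `R_3`**: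
`R_3(𝒳,𝒵) = Θ₂·(Π·GF(X₃∩Z₃) − GF(X₃)·GF(Z₃)) − Θ₂·(GF(X₃)·GF(Z_{<3}) + GF(X_{<3})·GF(Z₃)) + e_{≥3}·GF(X_{<3})·GF(Z_{<3})`,
where `X₃ = atLeast 3 𝒳`, `X_{<3} = below 3 𝒳` (memo g47 §2, identity (P3); valid for all pairs of families). [this work] -/
theorem Rt_three_eq_bigHarris (F G : Finset (Finset α)) :
    Rt 3 F G = gf (bySize (· < 3)) * (PiP * gf (atLeast 3 F ∩ atLeast 3 G) - gf (atLeast 3 F) * gf (atLeast 3 G))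
      - gf (bySize (· < 3)) * (gf (atLeast 3 F) * gf (below 3 G) + gf (below 3 F) * gf (atLeast 3 G))
      + gf (bySize (3 ≤ ·)) * (gf (below 3 F) * gf (below 3 G)) := by
  unfold Rt
  rw [← atLeast_inter 3 F G, gf_eq_atLeast_add_below 3 F, gf_eq_atLeast_add_below 3 G,
    PiP_eq_bySize_lt_add_ge (α := α) 3]
  ring

/-! ### Squarefree coefficients -/

/-- **`[s^V] GF({S : p #S})·(GF(A)·GF(B)) = Σ_{S ⊆ V, p #S} #{(P,Q) ∈ A × B partitioning V∖S}`**: the squarefree coefficient of a size class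
times a product of two generating functions counts the 3-partitions `(S, P, Q)` of `V` with `p #S`, `P ∈ A`, `Q ∈ B`. [this work] -/
theorem coeff_ind_bySize_mul_gf_mul_gf (p : ℕ → Prop) [DecidablePred p] (A B : Finset (Finset α)) (V : Finset α) :
    (gf (bySize p : Finset (Finset α)) * (gf A * gf B)).coeff (ind V) = ∑ S ∈ V.powerset.filter (fun S => p #S), (pairsAt A B (V \ S) : ℤ) := by
  rw [coeff_gf_mul]
  have hidx : ((bySize p : Finset (Finset α)).filter fun S => ind S ≤ ind V) = V.powerset.filter fun S => p #S := by
    ext S; simp only [bySize, mem_filter, mem_powerset, subset_univ, true_and, ind_le_ind_iff]; tauto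
  rw [hidx]
  refine sum_congr rfl fun S hS => ?_
  rw [ind_sub_ind (mem_powerset.1 (mem_filter.1 hS).1), coeff_ind_gf_mul_gf_eq_card]
  rfl

omit [DecidableEq α] [Fintype α] in
/-- `#S < 3 ↔ #S ≤ 2` inside a powerset filter. [this work] -/
theorem filter_card_lt_three_eq (V : Finset α) :
    (V.powerset.filter fun S : Finset α => #S < 3) = V.powerset.filter fun S => #S ≤ 2 :=
  filter_congr fun S _ => by omega

/-- **THE SQUAREFREE ROW OF `R_3` IN BIG-HARRIS FORM**: for every finset `V`,
`[s^V] R_3(𝒳,𝒵) = Σ_{U ⊆ V, #U ≤ 2} κ(X₃,Z₃)(∅, V∖U) − Σ_{U ⊆ V, #U ≤ 2} (#pairs(X₃,Z_{<3})(V∖U) + #pairs(X_{<3},Z₃)(V∖U))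
  + Σ_{S ⊆ V, 3 ≤ #S} #pairs(X_{<3},Z_{<3})(V∖S)`,
where `#pairs(A,B)(T)` (`pairsAt`) counts the ordered pairs `(P,Q) ∈ A × B` partitioning `T`.  For up-sets the surpluses `κ` are `≥ 0`
(`kap_nonneg`); for LOOP-FREE pairs (`X_{<3}, Z_{<3}` = the edges) the negative block is
`Σ_{z ∈ E_Z} #{U : #U ≤ 2, V∖U∖z ∈ 𝒳} + Σ_{c ∈ E_X} #{U : #U ≤ 2, V∖U∖c ∈ 𝒵}` — a big member of one family complementary (in a top cube) to an
edge of the other — and the last block counts the disjoint (X-edge, Z-edge) pairs with at least three idle points (memo g47 §2, (★★)). [this work] -/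
theorem coeff_ind_Rt_three_eq_bigHarris (F G : Finset (Finset α)) (V : Finset α) :
    (Rt 3 F G).coeff (ind V) =
      (∑ U ∈ V.powerset.filter (fun U => #U ≤ 2), kap (atLeast 3 F) (atLeast 3 G) ∅ (V \ U))
      - (∑ U ∈ V.powerset.filter (fun U => #U ≤ 2),
          ((pairsAt (atLeast 3 F) (below 3 G) (V \ U) : ℤ) + pairsAt (below 3 F) (atLeast 3 G) (V \ U)))
      + ∑ S ∈ V.powerset.filter (fun S => 3 ≤ #S), (pairsAt (below 3 F) (below 3 G) (V \ S) : ℤ) := by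
  rw [Rt_three_eq_bigHarris, coeff_add, coeff_sub, coeff_ind_Theta_harris_eq_sum_kap, mul_add, coeff_add,
    coeff_ind_bySize_mul_gf_mul_gf, coeff_ind_bySize_mul_gf_mul_gf, coeff_ind_bySize_mul_gf_mul_gf, filter_card_lt_three_eq,
    ← sum_add_distrib]

/-- **Sufficient condition for the squarefree row (big-Harris form)**: if the Kleitman surpluses of the big parts on the top cubes of `2^V`
plus the small-small pairs with at least three idle points dominate the (big, small) complementary pairs of the top cubes, then
`[s^V] R_3(𝒳,𝒵) ≥ 0`. [this work] -/
theorem coeff_ind_Rt_three_nonneg_of_bigHarris_le (F G : Finset (Finset α)) (V : Finset α)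
    (h : (∑ U ∈ V.powerset.filter (fun U => #U ≤ 2),
          ((pairsAt (atLeast 3 F) (below 3 G) (V \ U) : ℤ) + pairsAt (below 3 F) (atLeast 3 G) (V \ U)))
        ≤ (∑ U ∈ V.powerset.filter (fun U => #U ≤ 2), kap (atLeast 3 F) (atLeast 3 G) ∅ (V \ U))
          + ∑ S ∈ V.powerset.filter (fun S => 3 ≤ #S), (pairsAt (below 3 F) (below 3 G) (V \ S) : ℤ)) :
    0 ≤ (Rt 3 F G).coeff (ind V) := by
  rw [coeff_ind_Rt_three_eq_bigHarris]
  linarith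

end Summit.CriticalPhenomena.PercolationContinuityZ3.Theorems.SahiCTCForms
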